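import Mathlib.Analysis.Fourier.AddCircle
import Mathlib.Analysis.Calculus.ParametricIntervalIntegral
import HarnessLib

/-!
# Fourier modes of periodic functions with a parameter: differentiation rules

Analysis/Fourier support file (1-D calculus; theorem-only apart from one abbreviation). In
separation-of-variables arguments (e.g. Carter's separation of the wave equation on Kerr,
Dafermos–Rodnianski–Shlapentokh-Rothman arXiv:1402.7034 §5.2.2–§5.2.3) one passes from a PDE
in `(θ, φ)` (or `(t, θ, φ)`) to ODEs for the Fourier modes in the periodic variable `φ`. The two
rules needed are: the mode of `∂_φ g` is `(2πim/T)` times the mode of `g` (periodic integration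
by parts), and the mode of `g(θ, ·)` may be differentiated in the parameter `θ` under the
integral sign. For the circle of length `T` and Mathlib's characters
`fourier n (x : AddCircle T) = exp (2πinx/T)`:

* `modeCoeff T m g = ∫_0^T fourier (-m) φ · g φ dφ` — the (un-normalised) `m`-th mode of
  `g : ℝ → ℂ` on `[0, T]`; `modeCoeff_eq_mul_fourierCoeff` (`= T · fourierCoeff (liftIoc T 0 g) m`,
  the link with `fourierCoeff`, `fourierBasis`), `integral_haarAddCircle_eq_intervalIntegral`;
* `modeCoeff_hasDerivAt_eq` (**periodic integration by parts**): if `g' = dg/dφ` on `[0, T]` and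
  `g T = g 0` then `modeCoeff T m g' = (2πim/T) · modeCoeff T m g`; twice:
  `modeCoeff T m g'' = -(2πm/T)² · modeCoeff T m g` (`modeCoeff_hasDerivAt_hasDerivAt_eq`);
* `hasDerivAt_modeCoeff_param` (**differentiation in a parameter**): if `θ ↦ G θ φ` has
  derivative `Gθ θ φ` for all `θ, φ`, with `G`, `Gθ` jointly continuous, then
  `θ ↦ modeCoeff T m (G θ)` has derivative `modeCoeff T m (Gθ θ)`.

## Mathlib / tree search

Mathlib has `fourierCoeffOn_of_hasDerivAt` (integration by parts for `fourierCoeffOn`, `n ≠ 0`,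
with the boundary term), `hasDerivAt_fourier_neg`, `fourierCoeff_eq_intervalIntegral`,
`AddCircle.intervalIntegral_preimage`, and the parametric rule
`intervalIntegral.hasDerivAt_integral_of_dominated_loc_of_deriv_le`; the periodic corollaries
and the jointly-continuous parametric form are not there (searched `fourierCoeff.*deriv`,
`periodic.*fourierCoeff`). Tree: `FunctionSpaces/SmoothParametricIntegral.lean` (the `C^∞`
version for `ContDiff` integrands), not used here.

## References

* M. Dafermos, I. Rodnianski, Y. Shlapentokh-Rothman, arXiv:1402.7034, §5.2.2 (the modes
  `e^{imφ}`, `∂_φ ↦ im`, `∂_t ↦ -iω`). [DafermosRodnianskiShlapentokhrothman2014]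
* The differentiation rules themselves are standard calculus (integration by parts on a period;
  dominated differentiation under the integral sign) and are tagged `[folklore]`.
-/

noncomputable section

open MeasureTheory Set Filter Topology Real intervalIntegral Complex AddCircle
open scoped ComplexConjugate

namespace Literature.Analysis.Fourier

variable {T : ℝ}

/-! ### The modes -/

variable (T) in
/-- **The `m`-th Fourier mode on `[0, T]`** (un-normalised): `∫_0^T e^{-2πimφ/T} g(φ) dφ`.
[folklore] -/
def modeCoeff (m : ℤ) (g : ℝ → ℂ) : ℂ :=
  ∫ φ in (0 : ℝ)..T, fourier (-m) (φ : AddCircle T) * g φ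

/-- Unfolding. [folklore] -/
theorem modeCoeff_def (m : ℤ) (g : ℝ → ℂ) :
    modeCoeff T m g = ∫ φ in (0 : ℝ)..T, fourier (-m) (φ : AddCircle T) * g φ := rfl

/-- Linearity: constants. [folklore] -/
theorem modeCoeff_const_mul (m : ℤ) (c : ℂ) (g : ℝ → ℂ) :
    modeCoeff T m (fun φ ↦ c * g φ) = c * modeCoeff T m g := by
  rw [modeCoeff, modeCoeff, ← intervalIntegral.integral_const_mul]
  refine integral_congr fun φ _ ↦ ?_
  ring

/-- Linearity: sums (under integrability). [folklore] -/
theorem modeCoeff_add (m : ℤ) {g₁ g₂ : ℝ → ℂ} (h₁ : IntervalIntegrable g₁ volume 0 T)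
    (h₂ : IntervalIntegrable g₂ volume 0 T) :
    modeCoeff T m (fun φ ↦ g₁ φ + g₂ φ) = modeCoeff T m g₁ + modeCoeff T m g₂ := by
  have hc : Continuous fun φ : ℝ ↦ fourier (-m) (φ : AddCircle T) :=
    (map_continuous (fourier (-m))).comp (AddCircle.continuous_mk' T)
  rw [modeCoeff, modeCoeff, modeCoeff, ← intervalIntegral.integral_add
    (h₁.continuousOn_mul hc.continuousOn) (h₂.continuousOn_mul hc.continuousOn)]
  refine integral_congr fun φ _ ↦ ?_
  ring

/-- Integrals over the circle for the Haar probability measure are normalised interval integrals.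
[folklore] -/
theorem integral_haarAddCircle_eq_intervalIntegral [hT : Fact (0 < T)] (F : AddCircle T → ℂ) :
    ∫ z, F z ∂haarAddCircle = (1 / T : ℝ) • ∫ φ in (0 : ℝ)..T, F (φ : AddCircle T) := by
  have h := AddCircle.intervalIntegral_preimage T 0 F
  rw [zero_add] at h
  rw [h, volume_eq_smul_haarAddCircle, MeasureTheory.integral_smul_measure,
    ENNReal.toReal_ofReal hT.out.le, ← smul_assoc, smul_eq_mul, one_div_mul_cancel hT.out.ne',
    one_smul]

/-- **Link with `fourierCoeff`**: `modeCoeff T m g = T · fourierCoeff (liftIoc T 0 g) m`.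
[folklore] -/
theorem modeCoeff_eq_mul_fourierCoeff [hT : Fact (0 < T)] (m : ℤ) (g : ℝ → ℂ) :
    modeCoeff T m g = (T : ℂ) * fourierCoeff (AddCircle.liftIoc T 0 g) m := by
  rw [fourierCoeff_eq_intervalIntegral _ _ 0, zero_add, modeCoeff]
  have h : (∫ x in (0 : ℝ)..T, fourier (-m) (x : AddCircle T) • AddCircle.liftIoc T 0 g x) =
      ∫ x in (0 : ℝ)..T, fourier (-m) (x : AddCircle T) * g x := by
    refine intervalIntegral.integral_congr_ae (ae_of_all _ fun x hx ↦ ?_)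
    rw [uIoc_of_le hT.out.le] at hx
    rw [smul_eq_mul, AddCircle.liftIoc_coe_apply (by rwa [zero_add])]
  have hT0 : (T : ℂ) ≠ 0 := by exact_mod_cast hT.out.ne'
  rw [h, Complex.real_smul]
  push_cast
  rw [← mul_assoc, mul_one_div_cancel hT0, one_mul]

/-! ### Periodic integration by parts -/

/-- The character along `ℝ` takes the same value at `0` and `T`. [folklore] -/
theorem fourier_coe_period (n : ℤ) :
    fourier n ((T : ℝ) : AddCircle T) = fourier n ((0 : ℝ) : AddCircle T) := by
  rw [AddCircle.coe_period, QuotientAddGroup.mk_zero]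

/-- **Periodic integration by parts for modes**: if `g' = dg/dφ` on `[0, T]` and `g T = g 0`,
then `∫_0^T e_{-m} g' = (2πim/T) ∫_0^T e_{-m} g`. [folklore] -/
theorem modeCoeff_hasDerivAt_eq (m : ℤ) {g g' : ℝ → ℂ}
    (hg : ∀ φ ∈ uIcc 0 T, HasDerivAt g (g' φ) φ) (hg' : IntervalIntegrable g' volume 0 T)
    (hper : g T = g 0) :
    modeCoeff T m g' = (2 * π * I * m / T) * modeCoeff T m g := by
  have hu : ∀ φ ∈ uIcc 0 T, HasDerivAt (fun y : ℝ ↦ fourier (-m) (y : AddCircle T))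
      (-2 * π * I * m / T * fourier (-m) (φ : AddCircle T)) φ :=
    fun φ _ ↦ hasDerivAt_fourier_neg T m φ
  have hc : Continuous fun φ : ℝ ↦ fourier (-m) (φ : AddCircle T) :=
    (map_continuous (fourier (-m))).comp (AddCircle.continuous_mk' T)
  have h := integral_mul_deriv_eq_deriv_mul hu hg ((hc.const_mul _).intervalIntegrable _ _) hg'
  rw [modeCoeff, modeCoeff, h, hper, fourier_coe_period, sub_self, zero_sub,
    ← intervalIntegral.integral_neg, ← intervalIntegral.integral_const_mul]
  refine integral_congr fun φ _ ↦ ?_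
  ring

/-- **Second derivatives**: if moreover `g'' = dg'/dφ` on `[0, T]` and `g' T = g' 0`, then
`∫_0^T e_{-m} g'' = -(2πm/T)² ∫_0^T e_{-m} g`. [folklore] -/
theorem modeCoeff_hasDerivAt_hasDerivAt_eq [hT : Fact (0 < T)] (m : ℤ) {g g' g'' : ℝ → ℂ}
    (hg : ∀ φ ∈ uIcc 0 T, HasDerivAt g (g' φ) φ) (hg' : ∀ φ ∈ uIcc 0 T, HasDerivAt g' (g'' φ) φ)
    (hg'' : IntervalIntegrable g'' volume 0 T) (hper : g T = g 0) (hper' : g' T = g' 0) :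
    modeCoeff T m g'' = -((2 * π * m / T) ^ 2 : ℝ) * modeCoeff T m g := by
  have hg'i : IntervalIntegrable g' volume 0 T :=
    ContinuousOn.intervalIntegrable fun φ hφ ↦ (hg' φ hφ).continuousAt.continuousWithinAt
  rw [modeCoeff_hasDerivAt_eq m hg' hg'' hper', modeCoeff_hasDerivAt_eq m hg hg'i hper, ← mul_assoc]
  congr 1
  push_cast
  have hT0 : (T : ℂ) ≠ 0 := by exact_mod_cast hT.out.ne'
  field_simp
  rw [Complex.I_sq]
  ring

/-! ### Differentiation in a parameter -/

/-- **Differentiation of modes in a parameter** (under the integral sign): if `θ ↦ G θ φ` has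
derivative `Gθ θ φ` everywhere and `G`, `Gθ` are jointly continuous, then
`d/dθ ∫_0^T e_{-m}(φ) G θ φ dφ = ∫_0^T e_{-m}(φ) Gθ θ φ dφ`. [folklore] -/
theorem hasDerivAt_modeCoeff_param (m : ℤ) {G Gθ : ℝ → ℝ → ℂ}
    (hd : ∀ θ φ, HasDerivAt (fun θ ↦ G θ φ) (Gθ θ φ) θ)
    (hc : Continuous (Function.uncurry G)) (hcθ : Continuous (Function.uncurry Gθ)) (θ₀ : ℝ) :
    HasDerivAt (fun θ ↦ modeCoeff T m (G θ)) (modeCoeff T m (Gθ θ₀)) θ₀ := by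
  have he : Continuous fun φ : ℝ ↦ fourier (-m) (φ : AddCircle T) :=
    (map_continuous (fourier (-m))).comp (AddCircle.continuous_mk' T)
  -- a uniform bound for the derivative integrand on `[θ₀-1, θ₀+1] × [0, T]`
  have hK : IsCompact (Icc (θ₀ - 1) (θ₀ + 1) ×ˢ uIcc (0 : ℝ) T) :=
    isCompact_Icc.prod isCompact_uIcc
  obtain ⟨C, hC⟩ := hK.exists_bound_of_continuousOn
    ((he.norm.comp continuous_snd).mul hcθ.norm).continuousOn
  have hF : ∀ θ, Continuous fun φ : ℝ ↦ fourier (-m) (φ : AddCircle T) * G θ φ := fun θ ↦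
    he.mul (hc.comp (continuous_const.prodMk continuous_id))
  have hF' : ∀ θ, Continuous fun φ : ℝ ↦ fourier (-m) (φ : AddCircle T) * Gθ θ φ := fun θ ↦
    he.mul (hcθ.comp (continuous_const.prodMk continuous_id))
  have h := intervalIntegral.hasDerivAt_integral_of_dominated_loc_of_deriv_le
    (F := fun (θ : ℝ) (φ : ℝ) ↦ fourier (-m) (φ : AddCircle T) * G θ φ)
    (F' := fun (θ : ℝ) (φ : ℝ) ↦ fourier (-m) (φ : AddCircle T) * Gθ θ φ) (x₀ := θ₀)
    (s := Icc (θ₀ - 1) (θ₀ + 1)) (bound := fun _ ↦ C) (μ := volume) (a := 0) (b := T)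
    (Icc_mem_nhds (by linarith) (by linarith))
    (Eventually.of_forall fun θ ↦ (hF θ).aestronglyMeasurable)
    ((hF θ₀).intervalIntegrable _ _) ((hF' θ₀).aestronglyMeasurable)
    (ae_of_all _ fun φ hφ θ hθ ↦ by
      have := hC (θ, φ) ⟨hθ, uIoc_subset_uIcc hφ⟩
      simpa [norm_mul] using this)
    intervalIntegrable_const
    (ae_of_all _ fun φ _ θ _ ↦ (hd θ φ).const_mul _)
  exact h.2

end Literature.Analysis.Fourier
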